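import Summits.Schanuel.Schanuel.Theorems.RootDecomp1KW4Dossier01

/-!
# RootDecomp1KDigitPincer — lens 1, generation 66, NODE 26 «THE SECOND-ORDER 2-ADIC DIGIT PINCER ON THE K-LINE — the standing witness X6 = x³ + Y·x + Y⁷ + 3 decided: EMPTY AT EVERY LEVEL» (×0-as-record: node 9's toolkit programme §8 (a); the odd-middle pencil XP b c = x³ + b·x·Y + Y⁷ + c, b odd, EMPTY at every level N ≠ 1 with 2^N ≥ 2|b| + 9 + |c| and at N = 0, 2 ≤ N ≤ 6; X6P / X5P / X3P at every level; elementary: p_N ≡ 1 mod 2^(N!−(N−1)!) against the far-edge congruence and the real window; CLAIM L3006, PRICE L3009, ERRATUM E4, RULE K-R57, VERDICT L3015) — part 1 (RootDecomp1KDigitPincer01): §0 the pencil XP b c / X6P (node 25's X5P / X3P by proved equalities) + §1 parity + §2 (P1) clearing + §3 (P2)–(P3) den = 2^e, tie 7e = 3M + §4 (P4)–(P5) digit congruence + §5 (P6) window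

(lens-1 g66 NODE 26 «THE SECOND-ORDER 2-ADIC DIGIT PINCER ON THE K-LINE — the standing witness X6 = x³ + Y·x + Y⁷ + 3 decided: EMPTY AT EVERY LEVEL» L3013: HOME kernel K = HOME/decomp-schanuel-lens-1/g66/lean/DigitPincer.lean sha256 70263161…, 778 l, 67 decls, ONE namespace `Summit.Schanuel.Schanuel.Theorems.RootDecomp1KDigitPincer`, imports the tree port …RootDecomp1KW4Dossier01 ONLY; no private / instance / set_option / notation / sorry / decide; lens farm rc 0 · 0 errors · 0 sorries · 67 dupNamespace, axioms standard, Probe rc 0; CLAIM L3006 (ASK-FIRST under K-R56 (iii)(d)); crit g12 PRICE L3009: ×0-AS-RECORD (the pincer = node 9's TOOLKIT programme §8 (a) of RootDecomp1KDegreeLadder08 l.34–55), ERRATUM E4 («the dominant-far standing witnesses were reachable by the toolkit all along»: X6's certificate L3000 REVOKED, X5 MOOT, X3 struck (E3) ∧ decided), RULE K-R57 PRE-ANNOUNCED, CHECKLIST K-g66; writer g34 NOTE 13 L3008 (pre-check: precision (α) level N = 1, exact enumeration at levels 0–6); crit VERDICT L3015 (2026-09-02T01:34Z): CLEARED FOR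 THE RECORD ×0-AS-RECORD, CHECKLIST K-g66 (1)–(8) MET, RULE K-R57 FIXED (clauses (i)–(iv) of PRICE L3009 (4) verbatim + GLOSS K-R57), tally UNCHANGED lens-1 ×21 + THEOREM ×23, PORT GO → census-1 (source = K verbatim + provenance block; `--supports stmt-Schanuel-33364`, the item stays OPEN; RULE K-R57 (iv): UNCONDITIONAL PART ∪= these names). Port by census-1 gen 24 as `RootDecomp1KDigitPincer01–03` (×0 record port, no credit anywhere; files ≤ 400 lines): 01 = header + §0 the pencil `xc` / `XP b c` / `X6P` with `XP_one_two_eq_X5P` / `XP_one_zero_eq_X3P` (node 25's terms NOT re-declared) + §1 parity bookkeeping + §2 (P1) clearing denominators + §3 (P2)–(P3) den = 2^e and the tie 7e = 3M + §4 (P4)–(P5) the digit congruence 2^K ∣ a + 1 and a ≠ −1 + §5 (P6) the archimedean window; 02 = §6 the chain at a level N named step by step (`den_eq_two_pow_of_level`, `seven_e_eq_three_M`, `two_pow_dvd_num_add_one`, `num_ne_neg_one`, `abs_num_window`, …, `no_level_XP_of_pow_le`, `no_level_XP_lt_seven`, `levelFinite_XP`, `bddLevelEmpty_XP`, `thinFibreAt_XP`);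 03 = §7 BY NAME `no_level_one`, `no_level_X6P`, `levelSet_X6P_eq_empty`, `levelFinite_X6P`, `bddLevelEmpty_X6P`, `thinFibreAt_X6P`, `thinFibreAt_two_X6P`, the same five for the tree's `X5P` + §T territory `not_decidedAt_two_X6P`, `not_localAt_X6P`, `not_fermatTri_X6P`, `not_domSuper_X6P`, `not_domHyper_X6P`, `X6P_territory`. DROPPED AS A BLOCK (VERDICT L3015 option «the X3P twins may be kept or dropped as a block; say which»): the three twins `no_level_X3P_pincer` / `levelFinite_X3P_pincer` / `thinFibreAt_X3P_pincer` (K l.650–668) — their STATEMENTS coincide with node 25's landed `RootDecomp1KTrinomialDescent.no_level_X3P` / `levelFinite_X3P` / `thinFibreAt_X3P` and the gate's dedup.landed lint bounces such restatements; node 25's names stay the record for X3. Everything else = K VERBATIM (every declaration documented by the lens; statements, names and proofs unchanged; K's module docstring kept in part 01 below this provenance block).)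
-/

/-!
# RootDecomp1KDigitPincer — lens 1, generation 66, NODE 26 «THE SECOND-ORDER 2-ADIC DIGIT PINCER ON THE K-LINE —
the standing witness `X6 = x³ + Y·x + Y⁷ + 3` decided: EMPTY AT EVERY LEVEL» (CLAIM L3006 · PRICE L3009: mathematics
CORRECT, ×0-AS-RECORD = node 9's toolkit programme §8 (a), PORT WELCOME; ERRATUM E4; RULE K-R57 pre-announced)

HOME kernel `K = HOME/decomp-schanuel-lens-1/g66/lean/DigitPincer.lean`, ONE namespace
`Summit.Schanuel.Schanuel.Theorems.RootDecomp1KDigitPincer`, imports the tree port `…RootDecomp1KW4Dossier01` ONLY; the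
digit facts are the TREE's, used BY NAME (`psNumer`, `psNumer_succ` (DegreeLadder06), `coprime_psNumer`,
`partialSum_eq_psNumer_div` (TwoBaseCell06), `partialSum_lt_two`, `partialSum_pos'`, `partialSum_two_one`, `two_adic_tie`,
`two_adic_strict` (TrinomialDescent03), `levelFinite_of_no_level`, `thinFibreAt_of_levelFinite`,
`bddLevelEmpty_iff_levelFinite`, the terms `X5P`, `X3P` of node 25).  No `private`, no `instance`, no `set_option`, no
notation, no sorry, no `decide`/`native_decide` (`p_N` is never evaluated beyond `p_0 = 1`; `N ≥ 7` is symbolic), no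
Literature import, no named fact, no binder.

## PROVENANCE OF THE MOVE (checklist K-g66 (7)): node 9's §8 (a), `RootDecomp1KDegreeLadder08` l.34–55

«THE 2-ADIC MECHANISM.  The skeleton numerators converge 2-ADICALLY: `p_{M+1} = 2^{M·M!}·p_M + 1` … (a) If every `c_j`
with `g_j ≤ w` is RATIONAL, a bounded shift of `Z` is an S-integer within `2^{−N!·g}` (`g > w`) of `c₀` and one-prime
integer Ridout decides the branch.»  This file TYPES programme (a) at the far corner of the odd-middle pencil: `lc_Y = 1`,
`w = 3/7`, `Z = num r`, `c₀ = −1 ∈ ℤ`, gap `g = 1 − 1/N > w`; the Ridout call is unnecessary because `c₀ ∈ ℤ` (degree-1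
Liouville = divisibility).  It is NOT a new mechanism: it is the first typed decision of §8 (a) at `xdeg ≥ 2`, and it is
what exposed ERRATUM E4 (the «standing witnesses» X3/X6 of K-R54…K-R56 (ii) were reachable by the toolkit all along).

## THE CHAIN (P1)–(P6), for the ODD-MIDDLE PENCIL `XP b c = x³ + b·x·Y + Y⁷ + c` (`b` odd, `c ∈ ℤ`)

`b = 1`: `c = 3` is `X6P` (K-R56 (ii)'s witness, certificate L3000 REVOKED by E4), `c = 2` is node 25's nominee `X5P`
(MOOT by E4), `c = 0` is node 25's `X3P`.  At a level `N ≠ 1` the abscissa is `s_N = p_N/2^{N!}` with `p_N` ODD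
(`p_1 = 2` is even: `s_1 = 1`, and level 1 is genuinely special — `(b, c) = (1, −3)` HAS the level point `(1, 1)`), and a
level point `(s_N, a/d)` satisfies, with NO Diophantine theorem invoked:
(P1) `int_eq_of_root`: `u³d⁷ + b·u·a·d⁶·2^{2M} + a⁷·2^{3M} + c·d⁷·2^{3M} = 0` (`u = p_N`, `M = N!`);
(P2) `den_eq_two_pow_of_level`: `d = 2^e` (`e ≥ 1`), `a` odd;  (P3) `seven_e_eq_three_M`: the far edge TIES, `7e = 3·N!`
(tree `two_adic_tie` on three odd cofactors), so `7 ∣ N!`, `N ≥ 7` (`seven_le_of_level`) — levels `0, 2, …, 6` are EMPTY;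
(P4) `two_pow_dvd_num_add_one`: with `e = 3f`, `N! = 7f`, `K = N! − (N−1)!`: `u³ + a⁷ + b·u·a·2^{11f} + c·2^{21f} = 0`,
`u = 2^K·p_{N−1} + 1` (tree `psNumer_succ`) gives `2^K ∣ a⁷ + 1 = (a + 1)·Φ₁₄(a)` with `Φ₁₄(a)` ODD, so `2^K ∣ a + 1`;
(P5) `num_ne_neg_one`: `a ≠ −1`, else `p_{N−1}·(u² + u + 1)·2^K = (b·u − c·2^{10f})·2^{11f}` with both cofactors odd
forces `K = 11f > N! > K` (this is where `p_{N−1}` ODD — tree `coprime_psNumer`, `N − 1 ≥ 2` — is load-bearing);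
(P6) `abs_num_window`: `|a/d| ≤ 2|b| + 8 + |c|` from the equation and `0 < s_N < 2`; so
`2^K ≤ |a + 1| ≤ (2|b| + 8 + |c|)·2^e + 1 < (2|b| + 9 + |c|)·2^e`, while `K ≥ e + N` (`exp_gap`): impossible once
`2^N ≥ 2|b| + 9 + |c|`.  The product formula enters exactly once (`two_pow_le_abs_of_dvd`).

## STATEMENTS (hypothesis-free)

pencil: `no_level_XP_of_pow_le (hb : Odd b) (hN : 2·|b| + 9 + |c| ≤ 2^N) : ∀ r, bev (XP b c) (s_N) r ≠ 0`,
`no_level_XP_lt_seven (hb) (c) (N ≠ 1) (N < 7)`, `levelFinite_XP (hb) (c)`, `bddLevelEmpty_XP`, `thinFibreAt_XP (hb) (c) :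
∀ m₀, ThinFibreAt m₀ (XP b c)` (no `m₀`-guard); BY NAME: `no_level_X6P : ∀ N r, bev X6P (partialSum 2 N) r ≠ 0` (ALL `N`,
level 1 by the integer root test `no_level_one`), `levelSet_X6P_eq_empty`, `levelFinite_X6P`, `thinFibreAt_X6P : ∀ m₀`,
`thinFibreAt_two_X6P`, `bddLevelEmpty_X6P`; the same five for the tree's `X5P`; `no_level_X3P_pincer` /
`levelFinite_X3P_pincer` / `thinFibreAt_X3P_pincer` (twins of node 25's record facts by a second lever — node 25's names
STAY the record); territory `not_decidedAt_two_X6P`, `not_localAt_two_X6P`, `not_fermatTri_X6P`, `not_domSuper_X6P`,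
`not_domHyper_X6P` — the refusals BY NAME that made E4 possible, typed beside the theorem that decides the class.

## HONESTY (rung 0)

Nothing here proves Schanuel, `FiniteOrderLiouvilleSchanuel` (item 33364), 33363, 31077, the residual 31987, the uniform
`ThinFibre 2`, or any binder (`PadicSubspace`, `HeightComparison`, `SiegelShapes…` untouched).  `W4P` (the non-dominant
standing witness: top `Y⁴ − 17` non-constant, far-edge root `17^{1/4}` IRRATIONAL with two small quantities — §8 (b) /
p-adic Subspace territory, not §8 (a)) is NOT reached by this pincer.  K-R57 (iii)'s SECTOR THEOREM (programmes (a)+(b) as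
ONE engine for the whole constant-top dominant sector minus a typed §8-residue) is NOT claimed here: this file is ONE
pencil of programme (a).
-/

noncomputable section

namespace Summit.Schanuel.Schanuel.Theorems.RootDecomp1KDigitPincer

open Polynomial Finset
open LiouvilleNumber
open scoped Nat
open Summit.Schanuel.Schanuel.Theorems.RootDecomp1KDegreeLadder
open Summit.Schanuel.Schanuel.Theorems.RootDecomp1KXTop
open Summit.Schanuel.Schanuel.Theorems.RootDecomp1KXAll
open Summit.Schanuel.Schanuel.Theorems.RootDecomp1KLevelFinite
open Summit.Schanuel.Schanuel.Theorems.RootDecomp1KHeightGrading (BddLevelEmpty bddLevelEmpty_iff_levelFinite)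
open Summit.Schanuel.Schanuel.Theorems.RootDecomp1KOddEmpty (levelFinite_of_no_level)
open Summit.Schanuel.Schanuel.Theorems.RootDecomp1KTwoBaseCell (psNumer partialSum_eq_psNumer_div coprime_psNumer
  partialSum_lt_two partialSum_pos')
open Summit.Schanuel.Schanuel.Theorems.RootDecomp1KTrinomialDescent (two_adic_tie two_adic_strict X5P x5C X3P x3C
  FermatTri not_fermatTri_of_two_coeffs)
open Summit.Schanuel.Schanuel.Theorems.RootDecomp1KSuperellipticSiegel (DomSuper partialSum_two_one)
open Summit.Schanuel.Schanuel.Theorems.RootDecomp1KHyperellipticSiegel (DomHyper)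
open Summit.Schanuel.Schanuel.Theorems.RootDecomp1KXLinear (xLinP bev_xLinP XLinearLt)
open Summit.Schanuel.Schanuel.Theorems.RootDecomp1KLocalExponent (LocalAt SlopeCond RootCond)

/-! ## §0  THE ODD-MIDDLE PENCIL `XP b c = x³ + b·x·Y + Y⁷ + c` and the witness `X6P` -/

/-- [term] coefficient vector of the pencil: `c₃ = 1`, `c₁ = b·Y`, `c₀ = Y⁷ + c`. -/
def xc (b c : ℤ) : ℕ → ℤ[X] :=
  fun i => if i = 3 then 1 else if i = 1 then C b * X else if i = 0 then X ^ 7 + C c else 0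

/-- [term] **the pencil `XP b c := x³ + b·x·Y + Y⁷ + c`** (`xPolyP 3 (xc b c)`). -/
def XP (b c : ℤ) : ℤ[X][X] := xPolyP 3 (xc b c)

/-- [term] **`X6P = x³ + Y·x + Y⁷ + 3 := XP 1 3`** — the STANDING WITNESS of the dominant-far non-lacunary sector
(RULE K-R56 (ii), crit-1 WITNESS NOTE L3000; certificate REVOKED by ERRATUM E4 / PRICE L3009 precisely because this file
decides it): its FIRST tree name. -/
def X6P : ℤ[X][X] := XP 1 3

/-- `bev (XP b c) x y = x³ + b·x·y + y⁷ + c`. -/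
@[simp] theorem bev_XP (b c : ℤ) (x y : ℝ) : bev (XP b c) x y = x ^ 3 + b * x * y + y ^ 7 + c := by
  have h : bev (XP b c) x y = y ^ 7 + c + x * (b * y) + x ^ 3 := by
    simp [XP, xc, Finset.sum_range_succ]
  rw [h]; ring

/-- `X6P = XP 1 3` (by definition). -/
theorem X6P_eq : X6P = XP 1 3 := rfl

/-- node 25's nominee term `X5P = x³ + Y·x + Y⁷ + 2` is `XP 1 2`. -/
theorem X5P_eq : X5P = XP 1 2 := by
  have h : x5C = xc 1 2 := by
    funext i
    simp only [x5C, xc, map_one, one_mul]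
  rw [X5P, XP, h]

/-- node 25's `X3P = x³ + Y·x + Y⁷` is `XP 1 0`. -/
theorem X3P_eq : X3P = XP 1 0 := by
  have h : x3C = xc 1 0 := by
    funext i
    simp only [x3C, xc, map_one, one_mul, map_zero, add_zero]
  rw [X3P, XP, h]

/-- the PROVED equality `XP 1 2 = X5P` (tree `RootDecomp1KTrinomialDescent.X5P`, node 25; no re-declaration). -/
theorem XP_one_two_eq_X5P : XP 1 2 = X5P := X5P_eq.symm

/-- the PROVED equality `XP 1 0 = X3P` (tree `RootDecomp1KTrinomialDescent.X3P`, node 25; no re-declaration). -/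
theorem XP_one_zero_eq_X3P : XP 1 0 = X3P := X3P_eq.symm

/-- `bev X6P x y = x³ + x·y + y⁷ + 3`. -/
@[simp] theorem bev_X6P (x y : ℝ) : bev X6P x y = x ^ 3 + x * y + y ^ 7 + 3 := by
  rw [X6P_eq, bev_XP]; push_cast; ring

/-! ## §1  ODD / EVEN BOOKKEEPING -/

/-- the cofactor `Φ(a) = a⁶ − a⁵ + a⁴ − a³ + a² − a + 1` of `a⁷ + 1 = (a + 1)·Φ(a)` is ODD for odd `a`. -/
theorem odd_cofactor {a : ℤ} (ha : Odd a) :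
    Odd (a ^ 6 - a ^ 5 + a ^ 4 - a ^ 3 + a ^ 2 - a + 1) := by
  have h6 : Odd (a ^ 6) := ha.pow
  have h5 : Odd (a ^ 5) := ha.pow
  have h4 : Odd (a ^ 4) := ha.pow
  have h3 : Odd (a ^ 3) := ha.pow
  have h2 : Odd (a ^ 2) := ha.pow
  have hE : Even (a ^ 6 + a ^ 4 + a ^ 2 + 1) := ((h6.add_odd h4).add_odd h2).add_odd odd_one
  have hO : Odd (a ^ 5 + a ^ 3 + a) := (h5.add_odd h3).add_odd ha
  have h := hE.sub_odd hO
  have e : a ^ 6 + a ^ 4 + a ^ 2 + 1 - (a ^ 5 + a ^ 3 + a) = a ^ 6 - a ^ 5 + a ^ 4 - a ^ 3 + a ^ 2 - a + 1 := by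
    ring
  rw [e] at h
  exact h

/-- a power of two dividing `m·q` with `q` odd divides `m`. -/
theorem two_pow_dvd_of_dvd_mul_odd {K : ℕ} {m q : ℤ} (hq : Odd q) (h : (2 : ℤ) ^ K ∣ m * q) : (2 : ℤ) ^ K ∣ m := by
  have hcop : IsCoprime ((2 : ℤ) ^ K) q := by
    rw [Int.isCoprime_iff_nat_coprime, Int.natAbs_pow]
    have hq' : Odd q.natAbs := Int.natAbs_odd.mpr hq
    exact (Nat.coprime_two_left.mpr hq').pow_left K
  exact hcop.dvd_of_dvd_mul_right h

/-- `o·2^A = o'·2^B` with `o, o'` odd forces `A = B` (unique factorisation, via the tree's `two_adic_strict`). -/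
theorem two_pow_exp_eq {o o' : ℤ} (ho : Odd o) (ho' : Odd o') {A B : ℕ} (h : o * 2 ^ A = o' * 2 ^ B) : A = B := by
  by_contra hne
  rcases Nat.lt_or_gt_of_ne hne with hlt | hgt
  · exact two_adic_strict ho hlt hlt (x := -o') (y := 0) (by linear_combination h)
  · exact two_adic_strict ho' hgt hgt (x := -o) (y := 0) (by linear_combination -h)

/-- a NONZERO integer divisible by `2^K` has absolute value `≥ 2^K` (the product formula, once). -/
theorem two_pow_le_abs_of_dvd {K : ℕ} {m : ℤ} (h : (2 : ℤ) ^ K ∣ m) (hm : m ≠ 0) : (2 : ℝ) ^ K ≤ |(m : ℝ)| := by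
  have h1 : ((2 : ℤ) ^ K).natAbs ∣ m.natAbs := Int.natAbs_dvd_natAbs.mpr h
  rw [Int.natAbs_pow] at h1
  have h2 : 2 ^ K ≤ m.natAbs := Nat.le_of_dvd (Int.natAbs_pos.mpr hm) h1
  have h3 : ((2 ^ K : ℕ) : ℝ) ≤ (m.natAbs : ℝ) := by exact_mod_cast h2
  rw [Nat.cast_natAbs, Int.cast_abs] at h3
  exact_mod_cast h3

/-! ## §2  (P1) CLEARING DENOMINATORS at a dyadic abscissa `x = u / 2^M` -/

/-- `2^{3M}·d⁷·XP(u/2^M, a/d) = u³d⁷ + b·u·a·d⁶·2^{2M} + a⁷·2^{3M} + c·d⁷·2^{3M}` (`a = num r`, `d = den r`). -/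
theorem clear_XP (b c u : ℤ) (M : ℕ) (r : ℚ) :
    ((u ^ 3 * (r.den : ℤ) ^ 7 + b * u * r.num * (r.den : ℤ) ^ 6 * 2 ^ (2 * M) + r.num ^ 7 * 2 ^ (3 * M) +
        c * (r.den : ℤ) ^ 7 * 2 ^ (3 * M) : ℤ) : ℝ) =
      (r.den : ℝ) ^ 7 * (2 : ℝ) ^ (3 * M) * bev (XP b c) ((u : ℝ) / 2 ^ M) r := by
  have hnum : ((r.num : ℚ) : ℝ) = (r : ℝ) * (r.den : ℝ) := by
    have e : ((r * r.den : ℚ) : ℝ) = ((r.num : ℚ) : ℝ) := by rw [Rat.mul_den_eq_num]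
    push_cast at e ⊢
    exact e.symm
  rw [bev_XP]
  push_cast at hnum ⊢
  rw [hnum]
  have h2 : (2 : ℝ) ^ M ≠ 0 := pow_ne_zero _ two_ne_zero
  field_simp
  ring

/-- (P1) the INTEGER level equation at `x = u/2^M`. -/
theorem int_eq_of_root {b c u : ℤ} {M : ℕ} {r : ℚ} (h : bev (XP b c) ((u : ℝ) / 2 ^ M) r = 0) :
    u ^ 3 * (r.den : ℤ) ^ 7 + b * u * r.num * (r.den : ℤ) ^ 6 * 2 ^ (2 * M) + r.num ^ 7 * 2 ^ (3 * M) +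
        c * (r.den : ℤ) ^ 7 * 2 ^ (3 * M) = 0 := by
  have e := clear_XP b c u M r
  rw [h, mul_zero] at e
  exact_mod_cast e

/-! ## §3  (P2)–(P3) THE DENOMINATOR IS `2^e`, THE NUMERATOR IS ODD, AND THE FAR EDGE TIES: `7e = 3M` -/

/-- (P2)+(P3) **root shape**: at `x = u/2^M` (`u` odd, `M ≥ 1`), a rational root `r = a/d` of `XP b c` (`b` odd) has
`d = 2^e`, `a` odd, `7e = 3M`, and satisfies the TIED equation `(u³ + c·2^{3M})·2^{7e} + (b·u·a)·2^{6e+2M} + a⁷·2^{3M} = 0`. -/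
theorem root_shape {b c u : ℤ} (hb : Odd b) (hu : Odd u) {M : ℕ} (hM : 1 ≤ M) {r : ℚ}
    (h : bev (XP b c) ((u : ℝ) / 2 ^ M) r = 0) :
    ∃ e : ℕ, (r.den : ℤ) = 2 ^ e ∧ Odd r.num ∧ 7 * e = 3 * M ∧
      (u ^ 3 + c * 2 ^ (3 * M)) * 2 ^ (7 * e) + b * u * r.num * 2 ^ (6 * e + 2 * M) + r.num ^ 7 * 2 ^ (3 * M) = 0 := by
  have hE := int_eq_of_root h
  set a : ℤ := r.num with ha
  set d : ℕ := r.den with hd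
  -- (P2) d ∣ a⁷·2^{3M} and d ⊥ a ⟹ d ∣ 2^{3M} ⟹ d = 2^e
  have hdvd : (d : ℤ) ∣ a ^ 7 * 2 ^ (3 * M) := by
    refine ⟨-(u ^ 3 * (d : ℤ) ^ 6 + b * u * a * (d : ℤ) ^ 5 * 2 ^ (2 * M) + c * (d : ℤ) ^ 6 * 2 ^ (3 * M)), ?_⟩
    linear_combination hE
  have hred : Nat.Coprime d a.natAbs := Nat.coprime_comm.mp r.reduced
  have hcop : IsCoprime (d : ℤ) (a ^ 7) := by
    refine IsCoprime.pow_right ?_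
    rw [Int.isCoprime_iff_nat_coprime]
    simpa using hred
  have hd2 : (d : ℤ) ∣ 2 ^ (3 * M) := hcop.dvd_of_dvd_mul_left hdvd
  have hd2' : d ∣ 2 ^ (3 * M) := by exact_mod_cast hd2
  obtain ⟨e, -, hde⟩ := (Nat.dvd_prime_pow Nat.prime_two).1 hd2'
  have hdeZ : (d : ℤ) = 2 ^ e := by exact_mod_cast hde
  -- e ≥ 1: else u³ is even
  have he : 1 ≤ e := by
    by_contra he0
    have he0 : e = 0 := by omega
    rw [he0, pow_zero] at hdeZ
    rw [hdeZ] at hE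
    have hodd : Odd (u ^ 3 * 1 ^ 7 + b * u * a * 1 ^ 6 * 2 ^ (2 * M) + a ^ 7 * 2 ^ (3 * M) +
        c * 1 ^ 7 * 2 ^ (3 * M)) := by
      have h2M : Even ((2 : ℤ) ^ (2 * M)) := (even_two.pow_of_ne_zero (by omega))
      have h3M : Even ((2 : ℤ) ^ (3 * M)) := (even_two.pow_of_ne_zero (by omega))
      simp only [one_pow, mul_one]
      have t1 : Odd (u ^ 3) := hu.pow
      have t2 : Even (b * u * a * 2 ^ (2 * M)) := h2M.mul_left _
      have t3 : Even (a ^ 7 * 2 ^ (3 * M)) := h3M.mul_left _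
      have t4 : Even (c * 2 ^ (3 * M)) := h3M.mul_left _
      exact ((t1.add_even t2).add_even t3).add_even t4
    rw [hE] at hodd
    obtain ⟨k, hk⟩ := hodd
    omega
  -- a odd: coprime to d = 2^e with e ≥ 1
  have haodd : Odd a := by
    have hc : Nat.Coprime a.natAbs d := r.reduced
    rw [hde] at hc
    have hc2 : Nat.Coprime a.natAbs 2 := hc.coprime_dvd_right (dvd_pow_self 2 (by omega))
    exact Int.natAbs_odd.mp (Nat.coprime_two_right.mp hc2)
  -- (P3) the tied form and `two_adic_tie`
  have hT : (u ^ 3 + c * 2 ^ (3 * M)) * 2 ^ (7 * e) + b * u * a * 2 ^ (6 * e + 2 * M) + a ^ 7 * 2 ^ (3 * M) = 0 := by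
    rw [hdeZ] at hE
    have e1 : (2 : ℤ) ^ (7 * e) = (2 ^ e) ^ 7 := by rw [mul_comm 7 e, pow_mul]
    have e2 : (2 : ℤ) ^ (6 * e + 2 * M) = (2 ^ e) ^ 6 * 2 ^ (2 * M) := by rw [pow_add, mul_comm 6 e, pow_mul]
    rw [e1, e2]
    linear_combination hE
  have o1 : Odd (u ^ 3 + c * 2 ^ (3 * M)) :=
    (hu.pow).add_even ((even_two.pow_of_ne_zero (by omega)).mul_left c)
  have o2 : Odd (b * u * a) := (hb.mul hu).mul haodd
  have o3 : Odd (a ^ 7) := haodd.pow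
  have tie := two_adic_tie o1 o2 o3 hT
  have h73 : 7 * e = 3 * M := by omega
  exact ⟨e, hdeZ, haodd, h73, hT⟩

/-! ## §4  (P4)–(P5) THE DIGIT CONGRUENCE `2^K ∣ a + 1` AND `a ≠ −1` -/

/-- (P4)+(P5) **the pincer's arithmetic core.**  From the tied equation divided by `2^{21f}` —
`u³ + a⁷ + b·u·a·2^{11f} + c·2^{21f} = 0` — with `u = 2^K·p' + 1`, `p'` odd, `u, a, b` odd, `1 ≤ K < 7f`:
`2^K ∣ a + 1` and `a + 1 ≠ 0`. -/
theorem core {b c u p' a : ℤ} {K f : ℕ} (hb : Odd b) (hu : Odd u) (hup : u = 2 ^ K * p' + 1) (hp' : Odd p')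
    (ha : Odd a) (hK : 1 ≤ K) (hKf : K < 7 * f)
    (hE : u ^ 3 + a ^ 7 + b * u * a * 2 ^ (11 * f) + c * 2 ^ (21 * f) = 0) :
    (2 : ℤ) ^ K ∣ a + 1 ∧ a + 1 ≠ 0 := by
  have hf : 1 ≤ f := by omega
  -- u³ − 1 = 2^K · p' · (u² + u + 1)
  have hu3 : u ^ 3 - 1 = 2 ^ K * (p' * (u ^ 2 + u + 1)) := by
    have : u - 1 = 2 ^ K * p' := by rw [hup]; ring
    calc u ^ 3 - 1 = (u - 1) * (u ^ 2 + u + 1) := by ring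
      _ = 2 ^ K * (p' * (u ^ 2 + u + 1)) := by rw [this]; ring
  have hK11 : K ≤ 11 * f := by omega
  have hK21 : K ≤ 21 * f := by omega
  -- (P4) 2^K ∣ a⁷ + 1
  have hdvd7 : (2 : ℤ) ^ K ∣ a ^ 7 + 1 := by
    have e : a ^ 7 + 1 = -(b * u * a * 2 ^ (11 * f)) - c * 2 ^ (21 * f) - (u ^ 3 - 1) := by
      linear_combination hE
    rw [e, hu3]
    refine dvd_sub (dvd_sub (dvd_neg.mpr ?_) ?_) (dvd_mul_right _ _)
    · exact Dvd.dvd.mul_left (pow_dvd_pow 2 hK11) _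
    · exact Dvd.dvd.mul_left (pow_dvd_pow 2 hK21) _
  have hfac : a ^ 7 + 1 = (a + 1) * (a ^ 6 - a ^ 5 + a ^ 4 - a ^ 3 + a ^ 2 - a + 1) := by ring
  rw [hfac] at hdvd7
  have hdvd : (2 : ℤ) ^ K ∣ a + 1 := two_pow_dvd_of_dvd_mul_odd (odd_cofactor ha) hdvd7
  refine ⟨hdvd, fun ha1 => ?_⟩
  -- (P5) a = −1 forces v₂(u³ − 1) = 11f, but it is K < 7f ≤ 11f
  have ha' : a = -1 := by linear_combination ha1
  rw [ha'] at hE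
  -- u³ − 1 = 2^{11f} · (b·u − c·2^{10f})
  have h2 : u ^ 3 - 1 = 2 ^ (11 * f) * (b * u - c * 2 ^ (10 * f)) := by
    have e : (2 : ℤ) ^ (21 * f) = 2 ^ (11 * f) * 2 ^ (10 * f) := by rw [← pow_add]; ring_nf
    linear_combination hE - c * e
  have oL : Odd (p' * (u ^ 2 + u + 1)) := by
    refine hp'.mul ?_
    have : Even (u ^ 2 + u) := by
      have e : u ^ 2 + u = u * (u + 1) := by ring
      rw [e]; exact Int.even_mul_succ_self u
    exact this.add_odd odd_one
  have oR : Odd (b * u - c * 2 ^ (10 * f)) :=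
    (hb.mul hu).sub_even ((even_two.pow_of_ne_zero (by omega)).mul_left c)
  have heq : p' * (u ^ 2 + u + 1) * 2 ^ K = (b * u - c * 2 ^ (10 * f)) * 2 ^ (11 * f) := by
    linear_combination -hu3 + h2 + (hu3 - hu3)
  have := two_pow_exp_eq oL oR heq
  omega

/-! ## §5  (P6) THE ARCHIMEDEAN WINDOW -/

/-- the ordinate window: a real root `y` of `x³ + b·x·y + y⁷ + c = 0` with `0 < x < 2` has `|y| ≤ 2|b| + 8 + |c|`. -/
theorem window {b c : ℤ} {x y : ℝ} (hx0 : 0 < x) (hx2 : x < 2) (h : x ^ 3 + b * x * y + y ^ 7 + c = 0) :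
    |y| ≤ 2 * |(b : ℝ)| + 8 + |(c : ℝ)| := by
  set R : ℝ := 2 * |(b : ℝ)| + 8 + |(c : ℝ)| with hR
  have hR8 : 8 ≤ R := by
    have := abs_nonneg (b : ℝ); have := abs_nonneg (c : ℝ); linarith
  rcases le_or_gt |y| 1 with ht | ht
  · linarith
  set t : ℝ := |y| with htdef
  have ht0 : 0 < t := by linarith
  have hx3 : x ^ 3 < 8 := by
    have := pow_lt_pow_left₀ hx2 hx0.le (n := 3) (by norm_num)
    norm_num at this
    exact this
  -- t⁷ = |b x y + x³ + c| ≤ 2|b| t + 8 + |c| ≤ R·t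
  have h7 : t ^ 7 ≤ R * t := by
    have e : y ^ 7 = -(b * x * y + x ^ 3 + c) := by linear_combination h
    have h1 : t ^ 7 = |b * x * y + x ^ 3 + c| := by
      rw [htdef, ← abs_pow, e, abs_neg]
    have h2 : |b * x * y + x ^ 3 + c| ≤ |(b : ℝ)| * x * t + x ^ 3 + |(c : ℝ)| := by
      calc |b * x * y + x ^ 3 + c| ≤ |b * x * y| + |x ^ 3| + |(c : ℝ)| := abs_add_three _ _ _
        _ = |(b : ℝ)| * x * t + x ^ 3 + |(c : ℝ)| := by
          rw [abs_mul, abs_mul, abs_of_pos hx0, abs_of_pos (by positivity : (0:ℝ) < x ^ 3)]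
    have h3 : |(b : ℝ)| * x * t ≤ 2 * |(b : ℝ)| * t := by
      have e3 : |(b : ℝ)| * x * t = (|(b : ℝ)| * t) * x := by ring
      have e4 : 2 * |(b : ℝ)| * t = (|(b : ℝ)| * t) * 2 := by ring
      rw [e3, e4]
      exact mul_le_mul_of_nonneg_left hx2.le (mul_nonneg (abs_nonneg _) ht0.le)
    have h4 : |(c : ℝ)| ≤ |(c : ℝ)| * t := le_mul_of_one_le_right (abs_nonneg _) ht.le
    calc t ^ 7 = |b * x * y + x ^ 3 + c| := h1
      _ ≤ |(b : ℝ)| * x * t + x ^ 3 + |(c : ℝ)| := h2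
      _ ≤ 2 * |(b : ℝ)| * t + 8 * t + |(c : ℝ)| * t := by linarith
      _ = R * t := by rw [hR]; ring
  have h6 : t ^ 6 ≤ R := by
    have : t ^ 7 = t ^ 6 * t := by ring
    rw [this] at h7
    exact le_of_mul_le_mul_right h7 ht0
  have h1t : t ≤ t ^ 6 := le_self_pow₀ ht.le (by norm_num)
  linarith

end Summit.Schanuel.Schanuel.Theorems.RootDecomp1KDigitPincer
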